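import Summits.CriticalPhenomena.SAWScalingLimit.Theorems.SAWLoopFugacityFlowAvoidancePassageSandwich
import Summits.CriticalPhenomena.SAWScalingLimit.Theorems.SubseqIdentification.Negative.Necessity
import Literature.Probability.RandomPlanarGeometry.ConformalRestrictionProofs

/-!
# Stub `stub_avoidanceSandwich` of crux `LimitExists` (stmt-CriticalPhenomena-1371), line `registered`

The `≤` half of the portmanteau sandwich for two subsequential limits of the pushed-forward
critical SAW laws `Pₙ = (SAW.law D (s n) (a (s n)) (b (s n))).map curve` of a Dobrushin domain
`(D; a, b)` along `s n → 0⁺`: if the probability measure `ν` satisfies the OPEN portmanteau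
inequality `ν(G) ≤ liminf Pₙ(G)` along `(a, b, s)`, the probability measure `ν'` is carried by
curves with range in `cl D` meeting `∂D` only at the two marked points, and for every hull
super-domain `E` of `D` (Dobrushin, `E ⊆ D`, same marked points, agreeing with `D` near them) the
avoidance probabilities `Pₙ(range ⊆ cl E)` converge to some `c_E ≤ ν'(range ⊆ cl E)`, then
`ν(range ⊆ cl D') ≤ ν'(range ⊆ cl D')` for every Dobrushin `D' ⊆ D` with the same marked points.

Proof = the architecture of `avoidancePassage_proof` (stmt-CriticalPhenomena-4984) with the SLE law
replaced by `ν'`: exhaust `O = D ∖ cl D'` by compacts `K_k`; the SANDWICH LEMMA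
`AvoidancePassage.exists_superdomain` carves hull super-domains `E_k = D ∖ T_k ⊇ D'` (`T_k` closed,
off `cl D'`) missing `K_k`, admissible by `AvoidancePassage.exists_ball_inter_eq`; with the open
event `G_k = rangeSubset T_kᶜ ⊇ F = rangeSubset (cl D')` and `S = rangeSubset (cl D)`,
`G_k ∩ S ⊆ F_k = rangeSubset (cl E_k)`, so
`ν(F) ≤ ν(G_k) ≤ liminf Pₙ(G_k) ≤ liminf (Pₙ(F_k) + Pₙ(Sᶜ)) = c_k ≤ ν'(F_k)`, where `Pₙ(Sᶜ) = 0`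
eventually (the lattice endpoints are eventually distinct, `eventually_ne_of_hyps`, and then every SAW
polyline lies in `cl D`, `range_curve_subset_closure`). Finally `ν'(F_k) → ν'(F)` along the
carrier of `ν'`: a curve in infinitely many `F_k ∖ F` has a point of `D ∖ cl D'`, eventually interior
to `K_k`, inside `cl E_k` — impossible.

No named fact is assumed: the theorem is unconditional glue.
-/

noncomputable section

namespace Summit.CriticalPhenomena.SAWScalingLimit.Theorems.SAWRestrictionRigidityLimitExists

open Set Metric Filter Topology MeasureTheory
open scoped NNReal ENNReal
open Literature.Probability.RandomPlanarGeometry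
open Literature.Probability.LatticeModels (Site)

/-- **Stub (W) — THE AVOIDANCE SANDWICH** (the `≤` half of the portmanteau passage for two
subsequential limits; see the module docstring): under the open portmanteau inequality for `ν`,
the boundary-avoiding carrier of `ν'`, and convergence of the lattice avoidance probabilities of
every hull super-domain `E` of `D` to some `c_E ≤ ν'(range ⊆ cl E)`, one has
`ν(range ⊆ cl D') ≤ ν'(range ⊆ cl D')` for every Dobrushin `D' ⊆ D` with the same marked points.
[folklore] -/
theorem stub_avoidanceSandwich : ∀ (D : Literature.Probability.RandomPlanarGeometry.DobrushinDomain) (a b : ℝ → Literature.Probability.LatticeModels.Site 2), Literature.Probability.RandomPlanarGeometry.SAW.IsEndpointApprox D a b → ∀ (s : ℕ → ℝ) (ν ν' : MeasureTheory.Measure (Literature.Probability.RandomPlanarGeometry.CurveClass ℂ)), Filter.Tendsto s Filter.atTop (nhdsWithin 0 (Set.Ioi 0)) → MeasureTheory.IsProbabilityMeasure ν → MeasureTheory.IsProbabilityMeasure ν' → (∀ G : Set (Literature.Probability.RandomPlanarGeometry.CurveClass ℂ), IsOpen G → ν G ≤ Filter.liminf (fun n => ((Literature.Probability.RandomPlanarGeometry.SAW.law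 D.carrier (s n) (a (s n)) (b (s n))).map (fun γ => γ.curve)) G) Filter.atTop) → (∀ᵐ γ ∂ν', γ.range ⊆ closure D.carrier ∧ γ.range ∩ frontier D.carrier ⊆ {D.pt 0, D.pt 1}) → (∀ E : Literature.Probability.RandomPlanarGeometry.DobrushinDomain, E.carrier ⊆ D.carrier → E.pt 0 = D.pt 0 → E.pt 1 = D.pt 1 → (∃ ε : ℝ, 0 < ε ∧ E.carrier ∩ Metric.ball (D.pt 0) ε = D.carrier ∩ Metric.ball (D.pt 0) ε ∧ E.carrier ∩ Metric.ball (D.pt 1) ε = D.carrier ∩ Metric.ball (D.pt 1) ε) → ∃ c : ENNReal, Filter.Tendsto (fun n => ((Literature.Probability.RandomPlanarGeometry.SAW.law D.carrier (s n) (a (s n)) (b (s n))).map (fun γ => γ.curve)) (Literature.Probability.RandomPlanarGeometry.CurveClass.rangeSubset (closure E.carrier))) Filter.atTop (nhds c) ∧ c ≤ ν' (Literature.Probability.RandomPlanarGeometry.CurveClass.rangeSubset (closure E.carrier))) → ∀ D' : Literature.Probability.RandomPlanarGeometry.DobrushinDomain, D'.carrier ⊆ D.carrier → D'.pt 0 =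 D.pt 0 → D'.pt 1 = D.pt 1 → ν (Literature.Probability.RandomPlanarGeometry.CurveClass.rangeSubset (closure D'.carrier)) ≤ ν' (Literature.Probability.RandomPlanarGeometry.CurveClass.rangeSubset (closure D'.carrier)) := by
  intro D a b hab s ν ν' hs _hν hν' hopen hae hconv D' hD'sub h0 h1
  classical
  -- notation
  set P : ℕ → Measure (CurveClass ℂ) := fun n ↦
    (SAW.law D.carrier (s n) (a (s n)) (b (s n))).map (fun γ ↦ γ.curve) with hP
  set F : Set (CurveClass ℂ) := CurveClass.rangeSubset (closure D'.carrier) with hF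
  have hFm : MeasurableSet F := CurveClass.measurableSet_rangeSubset isClosed_closure
  have hmeas : ∀ n, Measurable
      (fun γ : SAW.DomainSAW D.carrier (s n) (a (s n)) (b (s n)) ↦ γ.curve) := fun n ↦
    SAW.DomainSAW.measurable_of_top _
  -- the event `range ⊆ cl D` has full mass, eventually
  set S : Set (CurveClass ℂ) := CurveClass.rangeSubset (closure D.carrier) with hS
  have hSm : MeasurableSet S := CurveClass.measurableSet_rangeSubset isClosed_closure
  have hSc0 : ∀ᶠ n in atTop, P n Sᶜ = 0 := by
    filter_upwards [SubseqIdentification.Negative.eventually_ne_of_hyps hab hs] with n hn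
    show ((SAW.law D.carrier (s n) (a (s n)) (b (s n))).map (fun γ ↦ γ.curve)) Sᶜ = 0
    rw [Measure.map_apply (hmeas n) hSm.compl]
    have hemp : (fun γ : SAW.DomainSAW D.carrier (s n) (a (s n)) (b (s n)) ↦ γ.curve) ⁻¹' Sᶜ
        = ∅ :=
      Set.eq_empty_iff_forall_notMem.2 fun γ hγ ↦
        hγ (SubseqIdentification.Negative.range_curve_subset_closure hn γ)
    rw [hemp, measure_empty]
  have hlimSc : Tendsto (fun n ↦ P n Sᶜ) atTop (𝓝 0) :=
    tendsto_const_nhds.congr' (hSc0.mono fun n hn ↦ hn.symm)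
  -- exhaustion of `O = D ∖ cl D'` by compacts
  set O : Set ℂ := D.carrier \ closure D'.carrier with hO
  have hOo : IsOpen O := D.isOpen.sdiff isClosed_closure
  have hOc : (Oᶜ).Nonempty := by
    obtain ⟨z, hz⟩ : (D.carrierᶜ).Nonempty := nonempty_compl.2 D.carrier_ne_univ
    exact ⟨z, fun hzO ↦ hz hzO.1⟩
  set K : ℕ → Set ℂ := fun k ↦ {z | 1 / ((k : ℝ) + 1) ≤ infDist z Oᶜ} with hK
  have hKO : ∀ k, K k ⊆ O := fun k z hz ↦ by
    by_contra hzO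
    have hd : infDist z Oᶜ = 0 := infDist_zero_of_mem hzO
    have hpos : (0 : ℝ) < 1 / ((k : ℝ) + 1) := by positivity
    have hz' : 1 / ((k : ℝ) + 1) ≤ infDist z Oᶜ := hz
    linarith
  have hKc : ∀ k, IsCompact (K k) := fun k ↦
    Metric.isCompact_of_isClosed_isBounded (isClosed_le continuous_const (continuous_infDist_pt _))
      (D.isBounded.subset ((hKO k).trans Set.sdiff_subset))
  have hKint : ∀ z ∈ O, ∃ k₀ : ℕ, ∀ k, k₀ ≤ k → z ∈ interior (K k) := by
    intro z hz
    have hd : 0 < infDist z Oᶜ :=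
      (hOo.isClosed_compl.notMem_iff_infDist_pos hOc).1 fun h ↦ h hz
    obtain ⟨k₀, hk₀⟩ := exists_nat_one_div_lt hd
    refine ⟨k₀, fun k hk ↦ ?_⟩
    have hsub : {w : ℂ | 1 / ((k : ℝ) + 1) < infDist w Oᶜ} ⊆ K k := fun w hw ↦
      show 1 / ((k : ℝ) + 1) ≤ infDist w Oᶜ from le_of_lt hw
    apply interior_mono hsub
    rw [(isOpen_lt continuous_const (continuous_infDist_pt _)).interior_eq]
    show 1 / ((k : ℝ) + 1) < infDist z Oᶜ
    have hk' : (k₀ : ℝ) + 1 ≤ (k : ℝ) + 1 := by exact_mod_cast Nat.add_le_add_right hk 1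
    calc 1 / ((k : ℝ) + 1) ≤ 1 / ((k₀ : ℝ) + 1) := one_div_le_one_div_of_le (by positivity) hk'
      _ < infDist z Oᶜ := hk₀
  -- the carved super-domains
  have hsup : ∀ k, ∃ (E : DobrushinDomain) (T : Set ℂ), IsClosed T ∧
      Disjoint T (closure D'.carrier) ∧ E.carrier = D.carrier \ T ∧ E.pt 0 = D.pt 0 ∧
      E.pt 1 = D.pt 1 ∧ Disjoint E.carrier (K k) := fun k ↦
    AvoidancePassage.exists_superdomain D D' hD'sub h0 h1 (hKc k)
      ((hKO k).trans Set.sdiff_subset) (Set.disjoint_left.2 fun z hz hzc ↦ (hKO k hz).2 hzc)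
  choose E T hTcl hTD' hEcar hE0 hE1 hEK using hsup
  have hptcl : ∀ i, D.pt i ∈ closure D'.carrier := by
    intro i
    fin_cases i
    · exact frontier_subset_closure (h0 ▸ D'.pt_mem_frontier 0)
    · exact frontier_subset_closure (h1 ▸ D'.pt_mem_frontier 1)
  have hptT : ∀ k i, D.pt i ∉ T k := fun k i h ↦ Set.disjoint_left.1 (hTD' k) h (hptcl i)
  set Fk : ℕ → Set (CurveClass ℂ) := fun k ↦ CurveClass.rangeSubset (closure (E k).carrier)
    with hFk
  have hFkm : ∀ k, MeasurableSet (Fk k) := fun k ↦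
    CurveClass.measurableSet_rangeSubset isClosed_closure
  -- the avoidance probabilities of the carved super-domains converge below `ν'`
  have hadm : ∀ k, ∃ c : ℝ≥0∞, Tendsto (fun n ↦ P n (Fk k)) atTop (𝓝 c) ∧ c ≤ ν' (Fk k) :=
    fun k ↦ hconv (E k) (by rw [hEcar k]; exact Set.sdiff_subset) (hE0 k) (hE1 k)
      (AvoidancePassage.exists_ball_inter_eq D (E k) (hTcl k) (hEcar k) (hptT k 0) (hptT k 1))
  choose c hc hcle using hadm
  -- `ν F ≤ ν' F_k` for every `k`
  have hνle : ∀ k, ν F ≤ ν' (Fk k) := by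
    intro k
    set G : Set (CurveClass ℂ) := CurveClass.rangeSubset (T k)ᶜ with hG
    have hGo : IsOpen G := CurveClass.isOpen_rangeSubset (hTcl k).isOpen_compl
    have hFG : F ⊆ G := fun γ hγ ↦ (show γ.range ⊆ closure D'.carrier from hγ).trans
      fun z hz hzT ↦ Set.disjoint_left.1 (hTD' k) hzT hz
    have hGS : G ∩ S ⊆ Fk k := by
      rintro γ ⟨hγG, hγS⟩
      show γ.range ⊆ closure (E k).carrier
      rw [hEcar k]
      intro z hz
      have h' : z ∈ closure D.carrier ∩ (T k)ᶜ := ⟨hγS hz, hγG hz⟩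
      exact (hTcl k).isOpen_compl.closure_inter h'
    calc ν F ≤ ν G := measure_mono hFG
      _ ≤ liminf (fun n ↦ P n G) atTop := hopen G hGo
      _ ≤ liminf (fun n ↦ P n (Fk k) + P n Sᶜ) atTop := by
          refine liminf_le_liminf (Eventually.of_forall fun n ↦ ?_)
          calc P n G ≤ P n (G ∩ S ∪ Sᶜ) := measure_mono fun γ hγ ↦ by
                  by_cases h : γ ∈ S
                  · exact Or.inl ⟨hγ, h⟩
                  · exact Or.inr h
            _ ≤ P n (G ∩ S) + P n Sᶜ := measure_union_le _ _
            _ ≤ P n (Fk k) + P n Sᶜ := add_le_add (measure_mono hGS) le_rfl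
      _ = c k := by
          have := (hc k).add hlimSc
          rw [add_zero] at this
          exact this.liminf_eq
      _ ≤ ν' (Fk k) := hcle k
  -- `ν' F_k → ν' F`: the limsup of the differences is `ν'`-null
  haveI : IsProbabilityMeasure ν' := hν'
  set A : ℕ → Set (CurveClass ℂ) := fun k ↦ ⋃ j, ⋃ (_ : k ≤ j), (Fk j \ F) with hA
  have hAm : ∀ k, MeasurableSet (A k) := fun k ↦
    MeasurableSet.iUnion fun j ↦ MeasurableSet.iUnion fun _ ↦ (hFkm j).diff hFm
  have hAanti : Antitone A := fun j k hjk ↦ iUnion₂_subset fun i hi ↦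
    subset_iUnion₂ (s := fun i (_ : j ≤ i) ↦ Fk i \ F) i (hjk.trans hi)
  have hAnull : ν' (⋂ k, A k) = 0 := by
    refine measure_mono_null ?_ (ae_iff.1 hae)
    intro γ hγ hgood
    obtain ⟨hγD, hγfr⟩ := hgood
    obtain ⟨j₀, -, hγj₀⟩ := mem_iUnion₂.1 (mem_iInter.1 hγ 0)
    have hγF : γ ∉ F := hγj₀.2
    obtain ⟨z, hz, hzD'⟩ : ∃ z ∈ γ.range, z ∉ closure D'.carrier := by
      by_contra h
      push Not at h
      exact hγF h
    have hzD : z ∈ D.carrier := by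
      have hzcl := hγD hz
      rw [closure_eq_self_union_frontier] at hzcl
      rcases hzcl with h | h
      · exact h
      · exfalso
        have hmem : z ∈ ({D.pt 0, D.pt 1} : Set ℂ) := hγfr ⟨hz, h⟩
        rcases hmem with h' | h'
        · exact hzD' (h' ▸ hptcl 0)
        · exact hzD' (h' ▸ hptcl 1)
    obtain ⟨k₀, hk₀⟩ := hKint z ⟨hzD, hzD'⟩
    obtain ⟨j, hj, hγj⟩ := mem_iUnion₂.1 (mem_iInter.1 hγ k₀)
    have hzint : z ∈ interior (K j) := hk₀ j hj
    have hzE : z ∈ closure (E j).carrier := hγj.1 hz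
    have hdis : Disjoint (closure (E j).carrier) (interior (K j)) :=
      ((hEK j).mono_right interior_subset).closure_left isOpen_interior
    exact Set.disjoint_left.1 hdis hzE hzint
  have hAlim : Tendsto (fun k ↦ ν' (A k)) atTop (𝓝 0) := by
    have := tendsto_measure_iInter_atTop (μ := ν') (fun k ↦ (hAm k).nullMeasurableSet) hAanti
      ⟨0, measure_ne_top ν' _⟩
    rw [hAnull] at this
    exact this
  -- conclusion
  have hbound : ∀ k, ν F ≤ ν' F + ν' (A k) := fun k ↦
    calc ν F ≤ ν' (Fk k) := hνle k
      _ ≤ ν' (F ∪ A k) := measure_mono fun γ hγ ↦ by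
          by_cases h : γ ∈ F
          · exact Or.inl h
          · exact Or.inr (mem_iUnion₂.2 ⟨k, le_rfl, hγ, h⟩)
      _ ≤ ν' F + ν' (A k) := measure_union_le _ _
  have hT : Tendsto (fun k ↦ ν' F + ν' (A k)) atTop (𝓝 (ν' F + 0)) :=
    tendsto_const_nhds.add hAlim
  rw [add_zero] at hT
  exact ge_of_tendsto' hT hbound

end Summit.CriticalPhenomena.SAWScalingLimit.Theorems.SAWRestrictionRigidityLimitExists

end
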